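import Mathlib
import HarnessLib
import Summits.HubbardSuperconductivity.HubbardSuperconductivity.Theorems.KLProgrammeKLRegimeTorusAdditiveWeightSum

/-!
# Route `KLProgramme` — engine support (route (L2), ADDITIVE weight, FIRST MOMENT): the squared isotropic distance weight against the inverse
# of the additive SEXTIC weight is summable on the space-time torus `(ℤ/Pℤ)¹ × (ℤ/Lℤ)²`, uniformly in `(P, L)`

Cell `gate-hubbard-kl`, seat p3 (g9), for the ENGINE child stmt-HubbardSuperconductivity-20437 (`stub_engine_step_norms`, the WEIGHTED lines
`KernelNormsWt4 … (klWtBudget …) … K_n j` at the levels `j ≥ 1`: the tree-WEIGHTED row/column sums `α_w` of the sectorised slice / block covariances,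
weight `klScaleWt … j = 1 + Λ_j·d`; design memo HOME/p3/g9/WT-DECAY-SCALES.md, evidence #17 on 20437).  The order-two twin is k3c2-p3's
`…TorusAdditiveWeightSum.sum_inv_additiveQuarticWeight_le` (the `Σ W⁻¹` factor of the `ℓ²` route to the PLAIN `ℓ¹` norm).  A FIRST MOMENT of a
space-time lattice kernel, `Σ_z (1 + Λ·d(z))‖g(z)‖`, goes by Cauchy–Schwarz `≤ √(Σ_z w²W⁻¹)·√(Σ_z W‖g‖²)` and needs `Σ_z w(z)²/W(z)` finite UNIFORMLY in
the volume — impossible with the quartic weight (`Σ_{z⃗} z₁²/(1 + s⁴(z₁⁴+z₂⁴)) ≍ s⁻⁴·log(Ls)`), true with the SEXTIC one (third single-direction differences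
on the Plancherel side).  In the five decay variables of the order-two file — `X = s₀|j̃|`, `I₁ = s₁|z̃₁|`, `I₂ = s₁|z̃₂|`, `Y = s₂|ã_{v⊥}(z)|`,
`Z = s₃|ã_v(z)|` — and with the isotropic moment numerator `(1 + X + I₁ + I₂)²` (every `klScaleWt`-type weight with `Λβ/(Ps₀) ≤ 1`, `Λ/s₁ ≤ 1` is below it):

  **`sum_sq_mul_inv_additiveSexticWeight_le`**: `Σ_{(j,z)} (1 + X + I₁ + I₂)²·(1 + X⁶ + I₁⁶ + I₂⁶ + Y⁶ + Z⁶)⁻¹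
      ≤ 32768·(1/s₀ + 1)·[C_w²·4·(2√2/(s₂|v|) + 2)(2√2/(s₃|v|) + 2) + 16·(1/s₁ + 1)²/(1 + s₁R₀)]`,
  `C_w = 1 + 2√2·s₁/(s₂|v|) + 2√2·s₁/(s₃|v|)` (near the origin the isotropic variables are controlled by the frame variables:
  `|v|²z̃ = (−v₂ã_{v⊥} + v₁ã_v, v₁ã_{v⊥} + v₂ã_v)`),

for every near radius `R₀` with `2(|v₁|+|v₂|)R₀ < L`.  Method = the order-two file's verbatim (near/far split, `valMinAbs_frame_eq_of_near`, the cubic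
dyadic layer cake `sum_inv_pow_le_of_card_le_cubic` at `m = 4`, the counts `card_filter_time_le` / `card_filter_frame_near_le` / `card_filter_torus_l1_le`)
after the power-mean step `(1 + a + b + c)⁶ ≤ 4⁵·(1 + a⁶ + b⁶ + c⁶)` and `numerator ≤ (C_w·f)²`: each point costs `1024·C_w²·f⁻⁴`.
Everything is proved; no definitions, no named facts. [folklore]

References: G. Benfatto, A. Giuliani, V. Mastropietro, Ann. Henri Poincaré 7 (2006) 809–898, Lemma 2.2 (2.52) (the `N`-th order decay whose `ℓ²`
shadow this is), §2.6 (2.81) and footnote ¹.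
-/

noncomputable section

namespace Summit.HubbardSuperconductivity.HubbardSuperconductivity.Theorems.TorusFourierL2

set_option linter.dupNamespace false -- summit = problem name (single-conjunct summit), D-0017

open Finset Literature.Probability.LatticeModels
open scoped Real

/-! ### §1 The power-mean step at order three -/

/-- `(1 + a + b + c)⁶ ≤ 1024·(1 + a⁶ + b⁶ + c⁶)` for `a, b, c ≥ 0` (power mean with four terms, `4⁵ = 1024`). [folklore] -/
theorem one_add_three_pow_six_le {a b c : ℝ} (ha : 0 ≤ a) (hb : 0 ≤ b) (hc : 0 ≤ c) :
    (1 + a + b + c) ^ 6 ≤ 1024 * (1 + a ^ 6 + b ^ 6 + c ^ 6) := by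
  have h := pow_sum_le_card_mul_sum_pow (s := (univ : Finset (Fin 4))) (f := ![1, a, b, c])
    (fun i _ => by fin_cases i <;> simp [ha, hb, hc]) 5
  simp only [Fin.sum_univ_four, Finset.card_univ, Fintype.card_fin] at h
  simp only [Matrix.cons_val_zero, Matrix.cons_val_one, Matrix.cons_val] at h
  norm_num at h
  linarith

/-- **The additive sextic weight dominates the sixth power of the sum**: `(1 + a⁶ + b⁶ + c⁶)⁻¹ ≤ 1024·((1 + a + b + c)⁻¹)⁶`. [folklore] -/
theorem inv_one_add_sextic_le {a b c : ℝ} (ha : 0 ≤ a) (hb : 0 ≤ b) (hc : 0 ≤ c) :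
    (1 + a ^ 6 + b ^ 6 + c ^ 6)⁻¹ ≤ 1024 * (1 + a + b + c)⁻¹ ^ 6 := by
  have h := one_add_three_pow_six_le ha hb hc
  have hpos : 0 < 1 + a ^ 6 + b ^ 6 + c ^ 6 := by positivity
  have hpos' : 0 < (1 + a + b + c) ^ 6 := by positivity
  rw [inv_pow, ← div_eq_mul_inv, le_div_iff₀ hpos', inv_mul_le_iff₀ hpos]
  linarith

/-- With a moment numerator `w ≤ C·f` (`0 ≤ w`, `1 ≤ f = 1 + a + b + c`): `w²·(1 + a⁶ + b⁶ + c⁶)⁻¹ ≤ 1024·C²·(f⁻¹)⁴`. [folklore] -/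
theorem sq_mul_inv_one_add_sextic_le {a b c w C : ℝ} (ha : 0 ≤ a) (hb : 0 ≤ b) (hc : 0 ≤ c) (hw : 0 ≤ w)
    (hwC : w ≤ C * (1 + a + b + c)) :
    w ^ 2 * (1 + a ^ 6 + b ^ 6 + c ^ 6)⁻¹ ≤ 1024 * C ^ 2 * (1 + a + b + c)⁻¹ ^ 4 := by
  have hf : 0 < 1 + a + b + c := by positivity
  have h1 := inv_one_add_sextic_le ha hb hc
  have hw2 : w ^ 2 ≤ (C * (1 + a + b + c)) ^ 2 := pow_le_pow_left₀ hw hwC 2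
  calc w ^ 2 * (1 + a ^ 6 + b ^ 6 + c ^ 6)⁻¹ ≤ (C * (1 + a + b + c)) ^ 2 * (1024 * (1 + a + b + c)⁻¹ ^ 6) :=
        mul_le_mul hw2 h1 (inv_nonneg.2 (by positivity)) (by positivity)
    _ = 1024 * C ^ 2 * (((1 + a + b + c) * (1 + a + b + c)⁻¹) ^ 2 * (1 + a + b + c)⁻¹ ^ 4) := by ring
    _ = 1024 * C ^ 2 * (1 + a + b + c)⁻¹ ^ 4 := by rw [mul_inv_cancel₀ hf.ne', one_pow, one_mul]

/-! ### §2 Near the origin the isotropic variables are controlled by the frame variables -/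

/-- `|v₁| + |v₂| ≤ √2·|v|`. [folklore] -/
theorem abs_add_abs_le_sqrt_two_mul_norm (v : Fin 2 → ℤ) :
    |(v 0 : ℝ)| + |(v 1 : ℝ)| ≤ Real.sqrt 2 * Real.sqrt ((v 0 : ℝ) ^ 2 + (v 1 : ℝ) ^ 2) := by
  rw [← Real.sqrt_mul (by norm_num : (0 : ℝ) ≤ 2)]
  have h0 := abs_nonneg (v 0 : ℝ)
  have h1 := abs_nonneg (v 1 : ℝ)
  have e0 : |(v 0 : ℝ)| ^ 2 = (v 0 : ℝ) ^ 2 := sq_abs _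
  have e1 : |(v 1 : ℝ)| ^ 2 = (v 1 : ℝ) ^ 2 := sq_abs _
  have hsq : (|(v 0 : ℝ)| + |(v 1 : ℝ)|) ^ 2 ≤ 2 * ((v 0 : ℝ) ^ 2 + (v 1 : ℝ) ^ 2) := by
    nlinarith [sq_nonneg (|(v 0 : ℝ)| - |(v 1 : ℝ)|), e0, e1]
  have h := Real.abs_le_sqrt hsq
  rwa [abs_of_nonneg (by positivity)] at h

/-- **In the near region the isotropic `ℓ¹` size is bounded by the frame sizes**: if `ã_{v⊥}(z) = −v₂z̃₁ + v₁z̃₂` and `ã_v(z) = v₁z̃₁ + v₂z̃₂`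
(the exact frame coordinates, `valMinAbs_frame_eq_of_near`), then `|z̃₁| + |z̃₂| ≤ (2√2/|v|)·(|ã_{v⊥}| + |ã_v|)`. [folklore] -/
theorem abs_add_abs_le_of_frame_eq {v : Fin 2 → ℤ} (hv : v ≠ 0) {z₀ z₁ Yv Zv : ℝ}
    (hY : Yv = (-(v 1 : ℝ)) * z₀ + (v 0 : ℝ) * z₁) (hZ : Zv = (v 0 : ℝ) * z₀ + (v 1 : ℝ) * z₁) :
    |z₀| + |z₁| ≤ 2 * Real.sqrt 2 / Real.sqrt ((v 0 : ℝ) ^ 2 + (v 1 : ℝ) ^ 2) * (|Yv| + |Zv|) := by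
  set r : ℝ := Real.sqrt ((v 0 : ℝ) ^ 2 + (v 1 : ℝ) ^ 2) with hr
  have hv2 : (0 : ℝ) < (v 0 : ℝ) ^ 2 + (v 1 : ℝ) ^ 2 := by
    rcases Function.ne_iff.1 hv with ⟨i, hi⟩
    fin_cases i
    · have : (v 0 : ℝ) ≠ 0 := by exact_mod_cast hi
      positivity
    · have : (v 1 : ℝ) ≠ 0 := by exact_mod_cast hi
      positivity
  have hr0 : 0 < r := Real.sqrt_pos.2 hv2
  have hr2 : r ^ 2 = (v 0 : ℝ) ^ 2 + (v 1 : ℝ) ^ 2 := Real.sq_sqrt hv2.le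
  -- inversion of the frame
  have e0 : r ^ 2 * z₀ = (-(v 1 : ℝ)) * Yv + (v 0 : ℝ) * Zv := by rw [hr2, hY, hZ]; ring
  have e1 : r ^ 2 * z₁ = (v 0 : ℝ) * Yv + (v 1 : ℝ) * Zv := by rw [hr2, hY, hZ]; ring
  have hsum := abs_add_abs_le_sqrt_two_mul_norm v
  rw [← hr] at hsum
  have b0 : r ^ 2 * |z₀| ≤ (|(v 0 : ℝ)| + |(v 1 : ℝ)|) * (|Yv| + |Zv|) := by
    have : r ^ 2 * |z₀| = |r ^ 2 * z₀| := by rw [abs_mul, abs_of_pos (pow_pos hr0 2)]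
    rw [this, e0]
    calc |(-(v 1 : ℝ)) * Yv + (v 0 : ℝ) * Zv| ≤ |(-(v 1 : ℝ)) * Yv| + |(v 0 : ℝ) * Zv| := abs_add_le _ _
      _ = |(v 1 : ℝ)| * |Yv| + |(v 0 : ℝ)| * |Zv| := by rw [abs_mul, abs_mul, abs_neg]
      _ ≤ (|(v 0 : ℝ)| + |(v 1 : ℝ)|) * (|Yv| + |Zv|) := by
          nlinarith [abs_nonneg (v 0 : ℝ), abs_nonneg (v 1 : ℝ), abs_nonneg Yv, abs_nonneg Zv]
  have b1 : r ^ 2 * |z₁| ≤ (|(v 0 : ℝ)| + |(v 1 : ℝ)|) * (|Yv| + |Zv|) := by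
    have : r ^ 2 * |z₁| = |r ^ 2 * z₁| := by rw [abs_mul, abs_of_pos (pow_pos hr0 2)]
    rw [this, e1]
    calc |(v 0 : ℝ) * Yv + (v 1 : ℝ) * Zv| ≤ |(v 0 : ℝ) * Yv| + |(v 1 : ℝ) * Zv| := abs_add_le _ _
      _ = |(v 0 : ℝ)| * |Yv| + |(v 1 : ℝ)| * |Zv| := by rw [abs_mul, abs_mul]
      _ ≤ (|(v 0 : ℝ)| + |(v 1 : ℝ)|) * (|Yv| + |Zv|) := by
          nlinarith [abs_nonneg (v 0 : ℝ), abs_nonneg (v 1 : ℝ), abs_nonneg Yv, abs_nonneg Zv]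
  have hYZ : 0 ≤ |Yv| + |Zv| := by positivity
  have key : r ^ 2 * (|z₀| + |z₁|) ≤ 2 * Real.sqrt 2 * r * (|Yv| + |Zv|) := by
    have := mul_le_mul_of_nonneg_right hsum hYZ
    nlinarith [b0, b1, this]
  rw [div_mul_eq_mul_div, le_div_iff₀ hr0]
  have : (|z₀| + |z₁|) * r * r = r ^ 2 * (|z₀| + |z₁|) := by ring
  nlinarith [key, hr0, abs_nonneg z₀, abs_nonneg z₁]

/-! ### §3 The moment sum -/

set_option maxHeartbeats 400000 in -- five pointwise/count blocks in one induction-free assembly (order-two twin: ≈ 180k)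
/-- **The squared isotropic distance weight against the inverse ADDITIVE SEXTIC weight is summable on the space-time torus, uniformly in `(P, L)`.**
For rates `s₀, s₁, s₂, s₃ > 0`, an integer direction `v ≠ 0` (frame `(v⊥, v)`, `|v| = √(v₁² + v₂²)`) and a near radius `R₀` with `2(|v₁|+|v₂|)R₀ < L`:
`Σ_{(j,z)} (1 + s₀|j̃| + s₁|z̃₁| + s₁|z̃₂|)²·(1 + (s₀|j̃|)⁶ + (s₁|z̃₁|)⁶ + (s₁|z̃₂|)⁶ + (s₂|ã_{v⊥}(z)|)⁶ + (s₃|ã_v(z)|)⁶)⁻¹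
  ≤ 32768·(1/s₀ + 1)·[C_w²·4·(2√2/(s₂|v|) + 2)(2√2/(s₃|v|) + 2) + 16·(1/s₁ + 1)²/(1 + s₁R₀)]`, `C_w = 1 + 2√2·s₁/(s₂|v|) + 2√2·s₁/(s₃|v|)`
— the `Σ w²W⁻¹` factor of the `ℓ²` route to the FIRST MOMENT of a space-time lattice kernel (third single-direction differences on the Plancherel side).
[cite: BenfattoGiulianiMastropietro2006, §2.6 (2.81) and footnote 1] -/
theorem sum_sq_mul_inv_additiveSexticWeight_le {P L : ℕ} [NeZero P] [NeZero L] (v : Fin 2 → ℤ) (hv : v ≠ 0) {s₀ s₁ s₂ s₃ : ℝ}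
    (hs₀ : 0 < s₀) (hs₁ : 0 < s₁) (hs₂ : 0 < s₂) (hs₃ : 0 < s₃) {R₀ : ℕ} (hR₀ : 2 * (|v 0| + |v 1|) * (R₀ : ℤ) < L) :
    ∑ q : TorusSite 1 P × TorusSite 2 L,
      (1 + s₀ * |(((q.1 0).valMinAbs : ℤ) : ℝ)| + s₁ * |(((q.2 0).valMinAbs : ℤ) : ℝ)| + s₁ * |(((q.2 1).valMinAbs : ℤ) : ℝ)|) ^ 2 *
      (1 + (s₀ * |(((q.1 0).valMinAbs : ℤ) : ℝ)|) ^ 6 + (s₁ * |(((q.2 0).valMinAbs : ℤ) : ℝ)|) ^ 6 +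
        (s₁ * |(((q.2 1).valMinAbs : ℤ) : ℝ)|) ^ 6 +
        (s₂ * |(((∑ j, ((![-v 1, v 0] j : ℤ) : ZMod L) * q.2 j).valMinAbs : ℤ) : ℝ)|) ^ 6 +
        (s₃ * |(((∑ j, ((v j : ℤ) : ZMod L) * q.2 j).valMinAbs : ℤ) : ℝ)|) ^ 6)⁻¹ ≤
      32768 * (1 / s₀ + 1) *
        ((1 + 2 * Real.sqrt 2 * s₁ / (s₂ * Real.sqrt ((v 0 : ℝ) ^ 2 + (v 1 : ℝ) ^ 2)) +
            2 * Real.sqrt 2 * s₁ / (s₃ * Real.sqrt ((v 0 : ℝ) ^ 2 + (v 1 : ℝ) ^ 2))) ^ 2 *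
          (4 * ((2 * Real.sqrt 2 / (s₂ * Real.sqrt ((v 0 : ℝ) ^ 2 + (v 1 : ℝ) ^ 2)) + 2) *
            (2 * Real.sqrt 2 / (s₃ * Real.sqrt ((v 0 : ℝ) ^ 2 + (v 1 : ℝ) ^ 2)) + 2)))
          + 16 * (1 / s₁ + 1) ^ 2 / (1 + s₁ * R₀)) := by
  classical
  -- the five decay variables
  set X : TorusSite 1 P × TorusSite 2 L → ℝ := fun q => s₀ * |(((q.1 0).valMinAbs : ℤ) : ℝ)| with hX
  set I₁ : TorusSite 1 P × TorusSite 2 L → ℝ := fun q => s₁ * |(((q.2 0).valMinAbs : ℤ) : ℝ)| with hI₁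
  set I₂ : TorusSite 1 P × TorusSite 2 L → ℝ := fun q => s₁ * |(((q.2 1).valMinAbs : ℤ) : ℝ)| with hI₂
  set Y : TorusSite 1 P × TorusSite 2 L → ℝ := fun q =>
    s₂ * |(((∑ j, ((![-v 1, v 0] j : ℤ) : ZMod L) * q.2 j).valMinAbs : ℤ) : ℝ)| with hY
  set Z : TorusSite 1 P × TorusSite 2 L → ℝ := fun q =>
    s₃ * |(((∑ j, ((v j : ℤ) : ZMod L) * q.2 j).valMinAbs : ℤ) : ℝ)| with hZ
  have hX0 : ∀ q, 0 ≤ X q := fun q => by positivity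
  have hI₁0 : ∀ q, 0 ≤ I₁ q := fun q => by positivity
  have hI₂0 : ∀ q, 0 ≤ I₂ q := fun q => by positivity
  have hY0 : ∀ q, 0 ≤ Y q := fun q => by positivity
  have hZ0 : ∀ q, 0 ≤ Z q := fun q => by positivity
  -- near / far
  let near : TorusSite 1 P × TorusSite 2 L → Prop := fun q => ∀ i, |((q.2 i).valMinAbs : ℤ)| ≤ R₀
  set Sn := (univ : Finset (TorusSite 1 P × TorusSite 2 L)).filter (fun q => near q) with hSn
  set Sf := (univ : Finset (TorusSite 1 P × TorusSite 2 L)).filter (fun q => ¬ near q) with hSf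
  set fn : TorusSite 1 P × TorusSite 2 L → ℝ := fun q => 1 + X q + Y q + Z q with hfn
  set ff : TorusSite 1 P × TorusSite 2 L → ℝ := fun q => 1 + X q + I₁ q + I₂ q with hff
  -- constants
  set r : ℝ := Real.sqrt ((v 0 : ℝ) ^ 2 + (v 1 : ℝ) ^ 2) with hr
  set Cw : ℝ := 1 + 2 * Real.sqrt 2 * s₁ / (s₂ * r) + 2 * Real.sqrt 2 * s₁ / (s₃ * r) with hCw
  set An : ℝ := 4 * (1 / s₀ + 1) * ((2 * Real.sqrt 2 / (s₂ * r) + 2) * (2 * Real.sqrt 2 / (s₃ * r) + 2)) with hAn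
  set Af : ℝ := 4 * (1 / s₀ + 1) * (4 * (1 / s₁ + 1) ^ 2) with hAf
  have hv2 : (0 : ℝ) < (v 0 : ℝ) ^ 2 + (v 1 : ℝ) ^ 2 := by
    rcases Function.ne_iff.1 hv with ⟨i, hi⟩
    fin_cases i
    · have : (v 0 : ℝ) ≠ 0 := by exact_mod_cast hi
      positivity
    · have : (v 1 : ℝ) ≠ 0 := by exact_mod_cast hi
      positivity
  have hr0 : 0 < r := Real.sqrt_pos.2 hv2
  have hCw1 : 1 ≤ Cw := by
    rw [hCw]
    have h1 : 0 ≤ 2 * Real.sqrt 2 * s₁ / (s₂ * r) := by positivity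
    have h2 : 0 ≤ 2 * Real.sqrt 2 * s₁ / (s₃ * r) := by positivity
    linarith
  have hCw0 : 0 ≤ Cw := zero_le_one.trans hCw1
  have hAn0 : 0 ≤ An := by positivity
  have hAf0 : 0 ≤ Af := by positivity
  -- (1) pointwise reductions
  have hnear_mom : ∀ q ∈ Sn, ff q ≤ Cw * fn q := by
    intro q hq
    have hqn : near q := (mem_filter.1 hq).2
    obtain ⟨e1, e2⟩ := valMinAbs_frame_eq_of_near v hR₀ q.2 hqn
    have hfr := abs_add_abs_le_of_frame_eq (z₀ := (((q.2 0).valMinAbs : ℤ) : ℝ)) (z₁ := (((q.2 1).valMinAbs : ℤ) : ℝ)) hv e1 e2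
    -- `I₁ + I₂ ≤ (2√2 s₁/(s₂ r))·Y + (2√2 s₁/(s₃ r))·Z`
    have hI : I₁ q + I₂ q ≤ 2 * Real.sqrt 2 * s₁ / (s₂ * r) * Y q + 2 * Real.sqrt 2 * s₁ / (s₃ * r) * Z q := by
      have h := mul_le_mul_of_nonneg_left hfr hs₁.le
      rw [← hr] at h
      have eI : I₁ q + I₂ q = s₁ * (|(((q.2 0).valMinAbs : ℤ) : ℝ)| + |(((q.2 1).valMinAbs : ℤ) : ℝ)|) := by
        simp only [hI₁, hI₂]; ring
      have eY : 2 * Real.sqrt 2 * s₁ / (s₂ * r) * Y q =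
          s₁ * (2 * Real.sqrt 2 / r) * |(((∑ j, ((![-v 1, v 0] j : ℤ) : ZMod L) * q.2 j).valMinAbs : ℤ) : ℝ)| := by
        simp only [hY]; field_simp
      have eZ : 2 * Real.sqrt 2 * s₁ / (s₃ * r) * Z q =
          s₁ * (2 * Real.sqrt 2 / r) * |(((∑ j, ((v j : ℤ) : ZMod L) * q.2 j).valMinAbs : ℤ) : ℝ)| := by
        simp only [hZ]; field_simp
      rw [eI, eY, eZ]
      have : s₁ * (2 * Real.sqrt 2 / r * (|(((∑ j, ((![-v 1, v 0] j : ℤ) : ZMod L) * q.2 j).valMinAbs : ℤ) : ℝ)| +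
          |(((∑ j, ((v j : ℤ) : ZMod L) * q.2 j).valMinAbs : ℤ) : ℝ)|)) =
          s₁ * (2 * Real.sqrt 2 / r) * |(((∑ j, ((![-v 1, v 0] j : ℤ) : ZMod L) * q.2 j).valMinAbs : ℤ) : ℝ)| +
            s₁ * (2 * Real.sqrt 2 / r) * |(((∑ j, ((v j : ℤ) : ZMod L) * q.2 j).valMinAbs : ℤ) : ℝ)| := by ring
      rw [← this]
      exact h
    have c1 : 2 * Real.sqrt 2 * s₁ / (s₂ * r) ≤ Cw := by
      rw [hCw]; have : 0 ≤ 2 * Real.sqrt 2 * s₁ / (s₃ * r) := by positivity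
      linarith
    have c2 : 2 * Real.sqrt 2 * s₁ / (s₃ * r) ≤ Cw := by
      rw [hCw]; have : 0 ≤ 2 * Real.sqrt 2 * s₁ / (s₂ * r) := by positivity
      linarith
    have hYc : 2 * Real.sqrt 2 * s₁ / (s₂ * r) * Y q ≤ Cw * Y q := mul_le_mul_of_nonneg_right c1 (hY0 q)
    have hZc : 2 * Real.sqrt 2 * s₁ / (s₃ * r) * Z q ≤ Cw * Z q := mul_le_mul_of_nonneg_right c2 (hZ0 q)
    have hXc : 1 + X q ≤ Cw * (1 + X q) := le_mul_of_one_le_left (by linarith [hX0 q]) hCw1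
    simp only [hff, hfn]
    nlinarith [hI, hYc, hZc, hXc]
  have hnear_pt : ∀ q ∈ Sn, ff q ^ 2 * (1 + X q ^ 6 + I₁ q ^ 6 + I₂ q ^ 6 + Y q ^ 6 + Z q ^ 6)⁻¹ ≤ 1024 * Cw ^ 2 * (fn q)⁻¹ ^ 4 := by
    intro q hq
    have h1 : (1 + X q ^ 6 + I₁ q ^ 6 + I₂ q ^ 6 + Y q ^ 6 + Z q ^ 6)⁻¹ ≤ (1 + X q ^ 6 + Y q ^ 6 + Z q ^ 6)⁻¹ :=
      inv_anti₀ (by positivity) (by nlinarith [pow_nonneg (hI₁0 q) 6, pow_nonneg (hI₂0 q) 6])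
    have hff0 : 0 ≤ ff q := by simp only [hff]; linarith [hX0 q, hI₁0 q, hI₂0 q]
    calc ff q ^ 2 * (1 + X q ^ 6 + I₁ q ^ 6 + I₂ q ^ 6 + Y q ^ 6 + Z q ^ 6)⁻¹ ≤ ff q ^ 2 * (1 + X q ^ 6 + Y q ^ 6 + Z q ^ 6)⁻¹ :=
          mul_le_mul_of_nonneg_left h1 (by positivity)
      _ ≤ 1024 * Cw ^ 2 * (1 + X q + Y q + Z q)⁻¹ ^ 4 :=
          sq_mul_inv_one_add_sextic_le (hX0 q) (hY0 q) (hZ0 q) hff0 (by simpa [hfn] using hnear_mom q hq)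
      _ = 1024 * Cw ^ 2 * (fn q)⁻¹ ^ 4 := by rw [hfn]
  have hfar_pt : ∀ q, ff q ^ 2 * (1 + X q ^ 6 + I₁ q ^ 6 + I₂ q ^ 6 + Y q ^ 6 + Z q ^ 6)⁻¹ ≤ 1024 * (ff q)⁻¹ ^ 4 := by
    intro q
    have h1 : (1 + X q ^ 6 + I₁ q ^ 6 + I₂ q ^ 6 + Y q ^ 6 + Z q ^ 6)⁻¹ ≤ (1 + X q ^ 6 + I₁ q ^ 6 + I₂ q ^ 6)⁻¹ :=
      inv_anti₀ (by positivity) (by nlinarith [pow_nonneg (hY0 q) 6, pow_nonneg (hZ0 q) 6])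
    have hff0 : 0 ≤ ff q := by simp only [hff]; linarith [hX0 q, hI₁0 q, hI₂0 q]
    calc ff q ^ 2 * (1 + X q ^ 6 + I₁ q ^ 6 + I₂ q ^ 6 + Y q ^ 6 + Z q ^ 6)⁻¹ ≤ ff q ^ 2 * (1 + X q ^ 6 + I₁ q ^ 6 + I₂ q ^ 6)⁻¹ :=
          mul_le_mul_of_nonneg_left h1 (by positivity)
      _ ≤ 1024 * 1 ^ 2 * (1 + X q + I₁ q + I₂ q)⁻¹ ^ 4 :=
          sq_mul_inv_one_add_sextic_le (hX0 q) (hI₁0 q) (hI₂0 q) hff0 (C := 1) (by simp [hff])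
      _ = 1024 * (ff q)⁻¹ ^ 4 := by rw [hff]; ring
  -- (2) the near count: `#{q ∈ Sn : fn q ≤ R} ≤ An·R³`
  have hcount_near : ∀ R : ℝ, 1 ≤ R → (((Sn.filter fun q => fn q ≤ R).card : ℕ) : ℝ) ≤ An * R ^ 3 := by
    intro R hR
    have hsub : (Sn.filter fun q => fn q ≤ R) ⊆ univ.filter (fun q : TorusSite 1 P × TorusSite 2 L =>
        s₀ * |(((q.1 0).valMinAbs : ℤ) : ℝ)| ≤ R ∧
        (s₂ * |(-(v 1 : ℝ)) * (((q.2 0).valMinAbs : ℤ) : ℝ) + (v 0 : ℝ) * (((q.2 1).valMinAbs : ℤ) : ℝ)| ≤ R ∧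
          s₃ * |(v 0 : ℝ) * (((q.2 0).valMinAbs : ℤ) : ℝ) + (v 1 : ℝ) * (((q.2 1).valMinAbs : ℤ) : ℝ)| ≤ R)) := by
      intro q hq
      rw [mem_filter] at hq
      have hqn : near q := (mem_filter.1 hq.1).2
      have hle : fn q ≤ R := hq.2
      obtain ⟨e1, e2⟩ := valMinAbs_frame_eq_of_near v hR₀ q.2 hqn
      refine mem_filter.2 ⟨mem_univ _, ?_, ?_, ?_⟩
      · have : X q ≤ R := by simp only [hfn] at hle; linarith [hY0 q, hZ0 q]
        simpa [hX] using this
      · have : Y q ≤ R := by simp only [hfn] at hle; linarith [hX0 q, hZ0 q]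
        rw [hY] at this; dsimp only at this; rwa [e1] at this
      · have : Z q ≤ R := by simp only [hfn] at hle; linarith [hX0 q, hY0 q]
        rw [hZ] at this; dsimp only at this; rwa [e2] at this
    have hprod := card_filter_prod_and_le (fun j : TorusSite 1 P => s₀ * |(((j 0).valMinAbs : ℤ) : ℝ)| ≤ R)
      (fun z : TorusSite 2 L => s₂ * |(-(v 1 : ℝ)) * (((z 0).valMinAbs : ℤ) : ℝ) + (v 0 : ℝ) * (((z 1).valMinAbs : ℤ) : ℝ)| ≤ R ∧
          s₃ * |(v 0 : ℝ) * (((z 0).valMinAbs : ℤ) : ℝ) + (v 1 : ℝ) * (((z 1).valMinAbs : ℤ) : ℝ)| ≤ R)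
      (fun q : TorusSite 1 P × TorusSite 2 L =>
        s₀ * |(((q.1 0).valMinAbs : ℤ) : ℝ)| ≤ R ∧
        (s₂ * |(-(v 1 : ℝ)) * (((q.2 0).valMinAbs : ℤ) : ℝ) + (v 0 : ℝ) * (((q.2 1).valMinAbs : ℤ) : ℝ)| ≤ R ∧
          s₃ * |(v 0 : ℝ) * (((q.2 0).valMinAbs : ℤ) : ℝ) + (v 1 : ℝ) * (((q.2 1).valMinAbs : ℤ) : ℝ)| ≤ R))
      (fun q h => h)
    have h1 := card_filter_time_le (P := P) hs₀ hR
    have h2 := card_filter_frame_near_le (L := L) v hv hs₂ hs₃ hR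
    calc (((Sn.filter fun q => fn q ≤ R).card : ℕ) : ℝ)
        ≤ ((univ.filter (fun j : TorusSite 1 P => s₀ * |(((j 0).valMinAbs : ℤ) : ℝ)| ≤ R)).card : ℝ) *
          ((univ.filter (fun z : TorusSite 2 L =>
            s₂ * |(-(v 1 : ℝ)) * (((z 0).valMinAbs : ℤ) : ℝ) + (v 0 : ℝ) * (((z 1).valMinAbs : ℤ) : ℝ)| ≤ R ∧
            s₃ * |(v 0 : ℝ) * (((z 0).valMinAbs : ℤ) : ℝ) + (v 1 : ℝ) * (((z 1).valMinAbs : ℤ) : ℝ)| ≤ R)).card : ℝ) := by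
          exact_mod_cast (card_le_card hsub).trans hprod
      _ ≤ (4 * (1 / s₀ + 1) * R) * (((2 * Real.sqrt 2 / (s₂ * r) + 2) * (2 * Real.sqrt 2 / (s₃ * r) + 2)) * R ^ 2) :=
          mul_le_mul h1 h2 (by positivity) (by positivity)
      _ = An * R ^ 3 := by rw [hAn]; ring
  -- (3) the far count: `#{q ∈ Sf : ff q ≤ R} ≤ Af·R³`, and `ff ≥ 1 + s₁R₀` on `Sf`
  have hcount_far : ∀ R : ℝ, 1 ≤ R → (((Sf.filter fun q => ff q ≤ R).card : ℕ) : ℝ) ≤ Af * R ^ 3 := by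
    intro R hR
    have hsub : (Sf.filter fun q => ff q ≤ R) ⊆ univ.filter (fun q : TorusSite 1 P × TorusSite 2 L =>
        s₀ * |(((q.1 0).valMinAbs : ℤ) : ℝ)| ≤ R ∧
        1 + s₁ * (|(((q.2 0).valMinAbs : ℤ) : ℝ)| + |(((q.2 1).valMinAbs : ℤ) : ℝ)|) ≤ R) := by
      intro q hq
      rw [mem_filter] at hq
      have hle : ff q ≤ R := hq.2
      refine mem_filter.2 ⟨mem_univ _, ?_, ?_⟩
      · have : X q ≤ R := by simp only [hff] at hle; linarith [hI₁0 q, hI₂0 q]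
        simpa [hX] using this
      · have : 1 + I₁ q + I₂ q ≤ R := by simp only [hff] at hle; linarith [hX0 q]
        simp only [hI₁, hI₂] at this; linarith
    have hprod := card_filter_prod_and_le (fun j : TorusSite 1 P => s₀ * |(((j 0).valMinAbs : ℤ) : ℝ)| ≤ R)
      (fun z : TorusSite 2 L => 1 + s₁ * (|(((z 0).valMinAbs : ℤ) : ℝ)| + |(((z 1).valMinAbs : ℤ) : ℝ)|) ≤ R)
      (fun q : TorusSite 1 P × TorusSite 2 L =>
        s₀ * |(((q.1 0).valMinAbs : ℤ) : ℝ)| ≤ R ∧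
        1 + s₁ * (|(((q.2 0).valMinAbs : ℤ) : ℝ)| + |(((q.2 1).valMinAbs : ℤ) : ℝ)|) ≤ R)
      (fun q h => h)
    have h1 := card_filter_time_le (P := P) hs₀ hR
    have h2 := card_filter_torus_l1_le (L := L) hs₁ hR
    calc (((Sf.filter fun q => ff q ≤ R).card : ℕ) : ℝ)
        ≤ ((univ.filter (fun j : TorusSite 1 P => s₀ * |(((j 0).valMinAbs : ℤ) : ℝ)| ≤ R)).card : ℝ) *
          ((univ.filter (fun z : TorusSite 2 L =>
            1 + s₁ * (|(((z 0).valMinAbs : ℤ) : ℝ)| + |(((z 1).valMinAbs : ℤ) : ℝ)|) ≤ R)).card : ℝ) := by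
          exact_mod_cast (card_le_card hsub).trans hprod
      _ ≤ (4 * (1 / s₀ + 1) * R) * (4 * (1 / s₁ + 1) ^ 2 * R ^ 2) := mul_le_mul h1 h2 (by positivity) (by positivity)
      _ = Af * R ^ 3 := by rw [hAf]; ring
  have hfar_min : ∀ q ∈ Sf, 1 + s₁ * R₀ ≤ ff q := by
    intro q hq
    have hq' : ¬ near q := (mem_filter.1 hq).2
    simp only [near, not_forall, not_le] at hq'
    obtain ⟨i, hi⟩ := hq'
    have hi' : (R₀ : ℝ) ≤ |(((q.2 i).valMinAbs : ℤ) : ℝ)| := by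
      rw [← Int.cast_abs]; exact_mod_cast hi.le
    have hsum : |(((q.2 i).valMinAbs : ℤ) : ℝ)| ≤ |(((q.2 0).valMinAbs : ℤ) : ℝ)| + |(((q.2 1).valMinAbs : ℤ) : ℝ)| := by
      have h := Finset.single_le_sum (f := fun i : Fin 2 => |(((q.2 i).valMinAbs : ℤ) : ℝ)|) (fun j _ => abs_nonneg _)
        (mem_univ i)
      rwa [Fin.sum_univ_two] at h
    have : s₁ * R₀ ≤ I₁ q + I₂ q := by
      simp only [hI₁, hI₂]; rw [← mul_add]; exact mul_le_mul_of_nonneg_left (hi'.trans hsum) hs₁.le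
    simp only [hff]; linarith [hX0 q]
  -- (4) the two dyadic sums
  have hnear_sum : ∑ q ∈ Sn, (fn q)⁻¹ ^ 4 ≤ 32 * An / 1 :=
    sum_inv_pow_le_of_card_le_cubic Sn fn le_rfl (fun q _ => by simp only [hfn]; linarith [hX0 q, hY0 q, hZ0 q]) hAn0
      hcount_near le_rfl
  have hRmin : (1 : ℝ) ≤ 1 + s₁ * R₀ := le_add_of_nonneg_right (by positivity)
  have hfar_sum : ∑ q ∈ Sf, (ff q)⁻¹ ^ 4 ≤ 32 * Af / (1 + s₁ * R₀) :=
    sum_inv_pow_le_of_card_le_cubic Sf ff hRmin hfar_min hAf0 hcount_far le_rfl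
  -- (5) assemble (the summand is `ff q ^ 2 * (…)⁻¹` by `rfl`)
  have hsplit := (sum_filter_add_sum_filter_not univ near
    (fun q : TorusSite 1 P × TorusSite 2 L => ff q ^ 2 * (1 + X q ^ 6 + I₁ q ^ 6 + I₂ q ^ 6 + Y q ^ 6 + Z q ^ 6)⁻¹)).symm
  calc ∑ q : TorusSite 1 P × TorusSite 2 L, ff q ^ 2 * (1 + X q ^ 6 + I₁ q ^ 6 + I₂ q ^ 6 + Y q ^ 6 + Z q ^ 6)⁻¹
      = ∑ q ∈ Sn, ff q ^ 2 * (1 + X q ^ 6 + I₁ q ^ 6 + I₂ q ^ 6 + Y q ^ 6 + Z q ^ 6)⁻¹ +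
          ∑ q ∈ Sf, ff q ^ 2 * (1 + X q ^ 6 + I₁ q ^ 6 + I₂ q ^ 6 + Y q ^ 6 + Z q ^ 6)⁻¹ := hsplit
    _ ≤ ∑ q ∈ Sn, 1024 * Cw ^ 2 * (fn q)⁻¹ ^ 4 + ∑ q ∈ Sf, 1024 * (ff q)⁻¹ ^ 4 :=
        add_le_add (sum_le_sum fun q hq => hnear_pt q hq) (sum_le_sum fun q _ => hfar_pt q)
    _ = 1024 * Cw ^ 2 * ∑ q ∈ Sn, (fn q)⁻¹ ^ 4 + 1024 * ∑ q ∈ Sf, (ff q)⁻¹ ^ 4 := by rw [mul_sum, mul_sum]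
    _ ≤ 1024 * Cw ^ 2 * (32 * An / 1) + 1024 * (32 * Af / (1 + s₁ * R₀)) := by gcongr
    _ = 32768 * (1 / s₀ + 1) * (Cw ^ 2 * (4 * ((2 * Real.sqrt 2 / (s₂ * r) + 2) * (2 * Real.sqrt 2 / (s₃ * r) + 2)))
          + 16 * (1 / s₁ + 1) ^ 2 / (1 + s₁ * R₀)) := by
        rw [hAn, hAf]
        have hden : (1 + s₁ * (R₀ : ℝ)) ≠ 0 := by positivity
        field_simp
        ring

end Summit.HubbardSuperconductivity.HubbardSuperconductivity.Theorems.TorusFourierL2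

end
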